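import Literature.Analysis.FluidPDE.ClassicalSolutionGalilean
import Literature.Analysis.FluidPDE.ClassicalSolutionTorusProofs
import Literature.Analysis.FluidPDE.TorusClassicalNSMaximalSolution
import Literature.Analysis.FluidPDE.TorusNSBealeKatoMajda
import Literature.Analysis.FunctionSpaces.TorusClassicalNSGluing
import Literature.Analysis.FunctionSpaces.FlatTorusProofs
import HarnessLib

/-!
# Galilean boosts of classical Navier–Stokes solutions on the flat torus, and the maximal solution /
# enstrophy door for data of ARBITRARY mean

Analysis/FluidPDE proof file (theorems only; no definitions, no named facts).

The tree states its local/maximal theory and its continuation criteria for CLASSICAL solutions of the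
unforced Navier–Stokes equations on `𝕋^d` (`Torus.IsClassicalNSSolutionOn`, `card d = 3`) for MEAN-ZERO
velocity slices (`Torus.exists_maximal_classicalNS`, `Torus.classicalNS_continuation_of_gradNormSq_le`, …;
Robinson–Rodrigo–Sadowski 2016 work throughout in the mean-zero space `H`, §1.8). The mean `∫_{𝕋^d} u(t)`
of an unforced classical solution is conserved (`Torus.IsClassicalNSSolutionOn.integral_velocity_eq`), and
the Galilean transformation `u ↦ u(t, x + t m) − m` (Majda–Bertozzi 2002 §1.2) removes it. This file makes
that reduction available once and for all:

* `Torus.isClassicalNSSolutionOn_galileanBoost` — **Galilean covariance on the torus**: if `(U, P)` is a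
  classical solution of the unforced system on a time set `S` of unique differentiability, so is
  `(U(t, · + proj(tV)) − V, P(t, · + proj(tV)))` (lift to `ℝ^d`, the tree's `galileanBoost_const`, descend:
  `IsClassicalNSSolutionOn.of_torus_holds` / `to_torus_holds`);
* `Torus.partialDeriv_comp_add_right_sub_const`, `Torus.gradNormSq_comp_add_right_sub_const`,
  `Torus.integral_comp_add_right_sub_const` — derivatives, `‖∇·‖₂²` and means under `x ↦ x + a`, `· − c`;
* `Torus.isDivFree_sub_const`, `Torus.isSmooth_sub_const` — subtracting a constant vector;
* `Torus.classicalNS_continuation_of_gradNormSq_le_anyMean` — **the enstrophy door without the mean-zero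
  hypothesis** (RRS 2016 Lemma 6.11): a classical solution on `[0,T) × 𝕋³` with `‖∇u(t)‖₂² ≤ E₁` continues
  to a classical solution on some `[0,T']`, `T' > T`;
* `Torus.exists_maximal_classicalNS_anyMean` — **the maximal solution and the blow-up alternative for
  smooth divergence-free data of arbitrary mean** (RRS 2016 §6.3/§8.1): global, or maximal on `[0,T*)` with
  unbounded enstrophy; with the uniqueness/maximality clauses of the mean-zero theorem.
* (rev 2) `Torus.torusVorticitySqAt_comp_add_right_sub_const`, `Torus.classicalNS_bkm_continuation_anyMean`
  (Beale–Kato–Majda 1984 / RRS Thm 12.3: a continuous vorticity majorant with bounded time integral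
  continues the solution — no mean-zero hypothesis) and
  `Torus.classicalNS_continuation_of_gradientSup_integral_le_anyMean` (`∇u ∈ L¹_t L^∞_x`, RRS Lemma 8.16 /
  Thm 12.3).

Motivation (cell ns-claims, D-0090): periodic-box claims are typed over data of arbitrary mean (C85
`Stanley2025` `T3GlobalRegularity`, C22 `Chaabani2020`, C13b `Kampen2015`, C21 `Lin2013` through the
ℝ³-periodic bridge of `Theorems/SoloSalvageLin2013*.lean`); every use of the tree's torus theory for them
starts with this reduction.

## References

* A. J. Majda, A. L. Bertozzi, *Vorticity and Incompressible Flow*, CUP 2002, §1.2 (Galilean invariance).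
  [`MajdaBertozzi2002`]
* J. C. Robinson, J. L. Rodrigo, W. Sadowski, *The three-dimensional Navier–Stokes equations*, CUP 2016,
  §1.8 (role of the mean on `𝕋³`), §6.3 p.108, §8.1 p.122, Lemma 6.11. [`RobinsonRodrigoSadowskiCUP2016`]
-/

noncomputable section

open MeasureTheory Set Filter
open scoped InnerProductSpace ContDiff

namespace Literature.Analysis.FluidPDE

open Literature.Analysis.FunctionSpaces

variable {d : Type*} [Fintype d] [DecidableEq d]

/-! ### Translates and constant shifts on the torus -/

omit [Fintype d] in
/-- `∂ᵢ (V(· + a) − c)(x) = (∂ᵢ V)(x + a)`: torus partial derivatives commute with translations and kill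
constants (the infinitesimal form of Galilean/translation invariance, Majda–Bertozzi 2002 §1.2).
[cite: MajdaBertozzi2002, §1.2 (translation and Galilean invariance)] -/
theorem Torus.partialDeriv_comp_add_right_sub_const {F : Type*} [NormedAddCommGroup F] [NormedSpace ℝ F]
    (i : d) (V : UnitAddTorus d → F) (a : UnitAddTorus d) (c : F) (x : UnitAddTorus d) :
    Torus.partialDeriv i (fun y => V (y + a) - c) x = Torus.partialDeriv i V (x + a) := by
  show deriv (fun t : ℝ => V (x + Torus.proj (t • EuclideanSpace.single i (1 : ℝ)) + a) - c) 0 =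
    deriv (fun t : ℝ => V (x + a + Torus.proj (t • EuclideanSpace.single i (1 : ℝ)))) 0
  rw [deriv_sub_const]
  congr 1
  funext t
  rw [add_right_comm]

/-- `‖∇(V(· + a) − c)‖₂² = ‖∇V‖₂²` (translation invariance of the Haar integral on `𝕋^d`; the
enstrophy is a Galilean invariant, Majda–Bertozzi 2002 §1.2).
[cite: MajdaBertozzi2002, §1.2 (translation and Galilean invariance)] -/
theorem Torus.gradNormSq_comp_add_right_sub_const (V : UnitAddTorus d → EuclideanSpace ℝ d)
    (a : UnitAddTorus d) (c : EuclideanSpace ℝ d) :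
    Torus.gradNormSq (fun y => V (y + a) - c) = Torus.gradNormSq V := by
  unfold Torus.gradNormSq
  have h : (fun x => ∑ i, ‖Torus.partialDeriv i (fun y => V (y + a) - c) x‖ ^ 2) =
      fun x => (fun z => ∑ i, ‖Torus.partialDeriv i V z‖ ^ 2) (x + a) := by
    funext x
    simp only [Torus.partialDeriv_comp_add_right_sub_const]
  rw [h]
  exact integral_add_right_eq_self (fun z => ∑ i, ‖Torus.partialDeriv i V z‖ ^ 2) a

omit [DecidableEq d] in
/-- `∫ (V(· + a) − c) = ∫ V − c` on the probability space `𝕋^d`, for integrable `V` (translation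
invariance of the integral of periodic functions, Grafakos §3.1.1). [cite: Grafakos2014, §3.1.1] -/
theorem Torus.integral_comp_add_right_sub_const {V : UnitAddTorus d → EuclideanSpace ℝ d}
    (hV : Integrable V volume) (a : UnitAddTorus d) (c : EuclideanSpace ℝ d) :
    ∫ x, (V (x + a) - c) = (∫ x, V x) - c := by
  rw [integral_sub (hV.comp_add_right a) (integrable_const c), integral_add_right_eq_self V a,
    integral_const, probReal_univ, one_smul]

/-- Subtracting a constant velocity keeps a field divergence free (the Galilean shift `u ↦ u − V`,
Majda–Bertozzi 2002 §1.2). [cite: MajdaBertozzi2002, §1.2 (Galilean invariance)] -/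
theorem Torus.isDivFree_sub_const {u : UnitAddTorus d → EuclideanSpace ℝ d} (hu : Torus.IsDivFree u)
    (c : EuclideanSpace ℝ d) : Torus.IsDivFree (fun y => u y - c) := by
  intro x
  have h := hu x
  unfold Torus.divergence at h ⊢
  rw [← h]
  refine Finset.sum_congr rfl fun i _ => ?_
  show deriv (fun t : ℝ => (u (x + Torus.proj (t • EuclideanSpace.single i (1 : ℝ))) - c) i) 0 =
    deriv (fun t : ℝ => u (x + Torus.proj (t • EuclideanSpace.single i (1 : ℝ))) i) 0
  have e : (fun t : ℝ => (u (x + Torus.proj (t • EuclideanSpace.single i (1 : ℝ))) - c) i) =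
      fun t : ℝ => u (x + Torus.proj (t • EuclideanSpace.single i (1 : ℝ))) i - c i := by
    funext t
    simp
  rw [e, deriv_sub_const]

omit [DecidableEq d] in
/-- Subtracting a constant keeps a field smooth (the Galilean shift `u ↦ u − V`, Majda–Bertozzi 2002
§1.2). [cite: MajdaBertozzi2002, §1.2 (Galilean invariance)] -/
theorem Torus.isSmooth_sub_const {F : Type*} [NormedAddCommGroup F] [NormedSpace ℝ F]
    {u : UnitAddTorus d → F} (hu : Torus.IsSmooth u) (c : F) : Torus.IsSmooth (fun y => u y - c) :=
  hu.sub (Torus.isSmooth_const c)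

/-! ### Galilean covariance on the torus -/

/-- **Galilean covariance of classical Navier–Stokes solutions on `𝕋^d`** (Majda–Bertozzi 2002 §1.2): if
`(U, P)` is a classical solution of the unforced system with viscosity `ν` on a time set `S` of unique
differentiability, then so is `(t, x) ↦ (U(t, x + proj(tV)) − V, P(t, x + proj(tV)))` for every constant
velocity `V ∈ ℝ^d`. Proof: lift to `ℝ^d` (`IsClassicalNSSolutionOn.of_torus_holds`), boost there
(`IsClassicalNSSolutionOn.galileanBoost_const`), and descend (`to_torus_holds`) — the boosted lifts are the
lifts of the boosted fields because `proj` is additive. [cite: MajdaBertozzi2002, §1.2 (Galilean invariance)] -/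
theorem Torus.isClassicalNSSolutionOn_galileanBoost {S : Set ℝ} (hS : UniqueDiffOn ℝ S) {ν : ℝ}
    {U : ℝ → UnitAddTorus d → EuclideanSpace ℝ d} {P : ℝ → UnitAddTorus d → ℝ}
    (h : Torus.IsClassicalNSSolutionOn S ν 0 U P) (V : EuclideanSpace ℝ d) :
    Torus.IsClassicalNSSolutionOn S ν 0 (fun t x => U t (x + Torus.proj (t • V)) - V)
      (fun t x => P t (x + Torus.proj (t • V))) := by
  have hlift : IsClassicalNSSolutionOn S ν
      (fun t => Torus.lift ((0 : ℝ → UnitAddTorus d → EuclideanSpace ℝ d) t))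
      (fun t => Torus.lift (U t)) (fun t => Torus.lift (P t)) :=
    IsClassicalNSSolutionOn.of_torus_holds h
  have h0 : (fun t => Torus.lift ((0 : ℝ → UnitAddTorus d → EuclideanSpace ℝ d) t)) =
      (0 : ℝ → EuclideanSpace ℝ d → EuclideanSpace ℝ d) := by
    funext t x
    simp [Torus.lift_apply]
  rw [h0] at hlift
  have hb := hlift.galileanBoost_const hS V
  apply IsClassicalNSSolutionOn.to_torus_holds
  rw [h0]
  exact hb

/-! ### The enstrophy door for data of arbitrary mean -/

/-- **Continuation from an enstrophy bound, any mean** (Robinson–Rodrigo–Sadowski 2016, Lemma 6.11, for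
data of arbitrary mean via the Galilean reduction): along a classical solution of the unforced
Navier–Stokes equations with `ν > 0` on `[0,T) × 𝕋^d`, `card d = 3`, if `‖∇u(t)‖₂² ≤ E₁` on `[0,T)` then
the solution continues to a classical solution on some `[0,T']`, `T' > T`, equal to `u` on `[0,T)`.
Proof: the mean `m = ∫u(0)` is conserved (`integral_velocity_eq`); the boost `u(t, · + proj(tm)) − m` has
mean-zero slices and the same enstrophy; apply `Torus.classicalNS_continuation_of_gradNormSq_le` and boost
back by `−m`. [cite: RobinsonRodrigoSadowskiCUP2016, Lemma 6.11 (with §1.8 on the mean)] -/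
theorem Torus.classicalNS_continuation_of_gradNormSq_le_anyMean (hd : Fintype.card d = 3) {ν T : ℝ}
    (hν : 0 < ν) (hT : 0 < T) {u : ℝ → UnitAddTorus d → EuclideanSpace ℝ d}
    {p : ℝ → UnitAddTorus d → ℝ} (h : Torus.IsClassicalNSSolutionOn (Ico 0 T) ν 0 u p) {E₁ : ℝ}
    (hE : ∀ t ∈ Ico 0 T, Torus.gradNormSq (u t) ≤ E₁) :
    ∃ T' : ℝ, T < T' ∧ ∃ (u' : ℝ → UnitAddTorus d → EuclideanSpace ℝ d)
      (p' : ℝ → UnitAddTorus d → ℝ), Torus.IsClassicalNSSolutionOn (Icc 0 T') ν 0 u' p' ∧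
        ∀ t ∈ Ico 0 T, u' t = u t := by
  have h0S : (0 : ℝ) ∈ Ico 0 T := ⟨le_rfl, hT⟩
  set m : EuclideanSpace ℝ d := ∫ y, u 0 y with hm
  have hmean : ∀ t ∈ Ico 0 T, ∫ y, u t y = m := fun t ht =>
    h.integral_velocity_eq (convex_Ico 0 T) (fun τ _ => by simp) h0S ht
  -- the boosted (mean-zero) solution
  have hv := Torus.isClassicalNSSolutionOn_galileanBoost (uniqueDiffOn_Ico 0 T) h m
  have hvmean : ∀ t ∈ Ico 0 T, Torus.HasZeroMean (fun x => u t (x + Torus.proj (t • m)) - m) := by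
    intro t ht
    unfold Torus.HasZeroMean
    rw [Torus.integral_comp_add_right_sub_const (h.smooth_velocity.isSmooth_slice ht).integrable,
      hmean t ht, sub_self]
  have hvE : ∀ t ∈ Ico 0 T, Torus.gradNormSq (fun x => u t (x + Torus.proj (t • m)) - m) ≤ E₁ := by
    intro t ht
    rw [Torus.gradNormSq_comp_add_right_sub_const]
    exact hE t ht
  obtain ⟨T', hTT', v', q', hv', -, hagree⟩ :=
    Torus.classicalNS_continuation_of_gradNormSq_le hd hν hT hv hvmean hvE
  refine ⟨T', hTT', fun t x => v' t (x + Torus.proj (t • (-m))) - (-m),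
    fun t x => q' t (x + Torus.proj (t • (-m))),
    Torus.isClassicalNSSolutionOn_galileanBoost (uniqueDiffOn_Icc (hT.trans hTT')) hv' (-m),
    fun t ht => ?_⟩
  funext x
  show v' t (x + Torus.proj (t • (-m))) - (-m) = u t x
  rw [hagree t ht]
  show u t (x + Torus.proj (t • (-m)) + Torus.proj (t • m)) - m - (-m) = u t x
  rw [add_assoc, ← Torus.proj_add, smul_neg, neg_add_cancel, Torus.proj_zero, add_zero, sub_neg_eq_add,
    sub_add_cancel]

/-! ### The maximal solution for data of arbitrary mean -/

/-- **The maximal classical solution and the blow-up alternative on `𝕋³`, arbitrary mean**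
(Robinson–Rodrigo–Sadowski 2016 §6.3 p.108, §8.1 p.122, for smooth divergence-free data of any mean via
the Galilean reduction). For `ν > 0` and a smooth divergence-free datum `u₀` on `𝕋^d`, `card d = 3`, there
is `(u, p)` with `u(0) = u₀` such that EITHER `(u, p)` is a global classical solution on `[0,∞) × 𝕋^d`
and every classical solution through `u₀` on a closed window `[0,b]` coincides with `u` there; OR there
is `0 < T* < ∞` with `(u, p)` classical on `[0,T*)`, its enstrophy unbounded on `[0,T*)`, and every
classical solution through `u₀` on `[0,b]` has `b < T*` and coincides with `u` on `[0,b]`. Proof: apply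
`Torus.exists_maximal_classicalNS` to the mean-zero datum `u₀ − m`, `m = ∫u₀`, and boost the result by
`−m`; competitors are boosted by `+m`. [cite: RobinsonRodrigoSadowskiCUP2016, §6.3 p. 108 and §8.1 p. 122 (with §1.8)] -/
theorem Torus.exists_maximal_classicalNS_anyMean (hd : Fintype.card d = 3) {ν : ℝ} (hν : 0 < ν)
    {u₀ : UnitAddTorus d → EuclideanSpace ℝ d} (hu₀ : Torus.IsSmooth u₀) (hdiv : Torus.IsDivFree u₀) :
    ∃ (u : ℝ → UnitAddTorus d → EuclideanSpace ℝ d) (p : ℝ → UnitAddTorus d → ℝ), u 0 = u₀ ∧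
      ((Torus.IsClassicalNSSolutionOn (Ici 0) ν 0 u p ∧
          ∀ (b : ℝ) (v : ℝ → UnitAddTorus d → EuclideanSpace ℝ d) (q : ℝ → UnitAddTorus d → ℝ),
            Torus.IsClassicalNSSolutionOn (Icc 0 b) ν 0 v q → v 0 = u₀ →
              ∀ s ∈ Icc 0 b, v s = u s) ∨
        ∃ T : ℝ, 0 < T ∧ Torus.IsClassicalNSSolutionOn (Ico 0 T) ν 0 u p ∧
          ¬ BddAbove ((fun t => Torus.gradNormSq (u t)) '' Ico 0 T) ∧
          ∀ (b : ℝ) (v : ℝ → UnitAddTorus d → EuclideanSpace ℝ d) (q : ℝ → UnitAddTorus d → ℝ),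
            Torus.IsClassicalNSSolutionOn (Icc 0 b) ν 0 v q → v 0 = u₀ →
              b < T ∧ ∀ s ∈ Icc 0 b, v s = u s) := by
  -- the mean-zero datum
  set m : EuclideanSpace ℝ d := ∫ y, u₀ y with hm
  have hV₀smooth : Torus.IsSmooth (fun x => u₀ x - m) := Torus.isSmooth_sub_const hu₀ m
  have hV₀div : Torus.IsDivFree (fun x => u₀ x - m) := Torus.isDivFree_sub_const hdiv m
  have hV₀mean : Torus.HasZeroMean (fun x => u₀ x - m) := by
    unfold Torus.HasZeroMean
    have h := Torus.integral_comp_add_right_sub_const hu₀.integrable 0 m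
    simp only [add_zero] at h
    rw [h, hm, sub_self]
  obtain ⟨W, Q, hW0, hcases⟩ := Torus.exists_maximal_classicalNS hd hν hV₀smooth hV₀div hV₀mean
  -- the boosted-back fields
  set u : ℝ → UnitAddTorus d → EuclideanSpace ℝ d :=
    fun t x => W t (x + Torus.proj (t • (-m))) - (-m) with hu
  set p : ℝ → UnitAddTorus d → ℝ := fun t x => Q t (x + Torus.proj (t • (-m))) with hp
  have hu0 : u 0 = u₀ := by
    funext x
    show W 0 (x + Torus.proj ((0 : ℝ) • (-m))) - (-m) = u₀ x
    rw [zero_smul, Torus.proj_zero, add_zero, hW0]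
    show u₀ x - m - (-m) = u₀ x
    rw [sub_neg_eq_add, sub_add_cancel]
  -- competitors: a classical solution through `u₀` on `[0,b]`, boosted by `+m`, goes through `u₀ − m`
  have hcomp : ∀ (b : ℝ) (v : ℝ → UnitAddTorus d → EuclideanSpace ℝ d) (q : ℝ → UnitAddTorus d → ℝ),
      0 < b → Torus.IsClassicalNSSolutionOn (Icc 0 b) ν 0 v q → v 0 = u₀ →
        Torus.IsClassicalNSSolutionOn (Icc 0 b) ν 0 (fun t x => v t (x + Torus.proj (t • m)) - m)
            (fun t x => q t (x + Torus.proj (t • m))) ∧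
          (fun x => v 0 (x + Torus.proj ((0 : ℝ) • m)) - m) = fun x => u₀ x - m := by
    intro b v q hb hv hv0
    refine ⟨Torus.isClassicalNSSolutionOn_galileanBoost (uniqueDiffOn_Icc hb) hv m, ?_⟩
    funext x
    rw [zero_smul, Torus.proj_zero, add_zero, hv0]
  -- reading the boosted identity back at `x + proj(s • (−m))`
  have hback : ∀ (v : ℝ → UnitAddTorus d → EuclideanSpace ℝ d) (s : ℝ),
      (fun x => v s (x + Torus.proj (s • m)) - m) = W s → v s = u s := by
    intro v s hvs
    funext x
    have hx : v s (x + Torus.proj (s • (-m)) + Torus.proj (s • m)) - m = W s (x + Torus.proj (s • (-m))) :=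
      congrFun hvs (x + Torus.proj (s • (-m)))
    rw [add_assoc, ← Torus.proj_add, ← smul_add, neg_add_cancel, smul_zero, Torus.proj_zero, add_zero] at hx
    show v s x = W s (x + Torus.proj (s • (-m))) - (-m)
    rw [← hx, sub_neg_eq_add, sub_add_cancel]
  refine ⟨u, p, hu0, ?_⟩
  rcases hcases with ⟨hWglob, -, hWuniq⟩ | ⟨T, hT, hWsol, -, hWunb, hWmax⟩
  · -- global branch
    refine Or.inl ⟨Torus.isClassicalNSSolutionOn_galileanBoost (uniqueDiffOn_Ici 0) hWglob (-m), ?_⟩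
    intro b v q hv hv0 s hs
    rcases le_or_gt b 0 with hb | hb
    · have hs0 : s = 0 := le_antisymm (hs.2.trans hb) hs.1
      rw [hs0, hv0, hu0]
    · obtain ⟨hv', hv'0⟩ := hcomp b v q hb hv hv0
      exact hback v s (hWuniq b _ _ hv' hv'0 s hs)
  · -- maximal branch
    refine Or.inr ⟨T, hT, Torus.isClassicalNSSolutionOn_galileanBoost (uniqueDiffOn_Ico 0 T) hWsol (-m),
      ?_, ?_⟩
    · have hfun : (fun t => Torus.gradNormSq (u t)) = fun t => Torus.gradNormSq (W t) := by
        funext t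
        exact Torus.gradNormSq_comp_add_right_sub_const (W t) _ _
      rw [hfun]
      exact hWunb
    · intro b v q hv hv0
      rcases le_or_gt b 0 with hb | hb
      · refine ⟨hb.trans_lt hT, fun s hs => ?_⟩
        have hs0 : s = 0 := le_antisymm (hs.2.trans hb) hs.1
        rw [hs0, hv0, hu0]
      · obtain ⟨hv', hv'0⟩ := hcomp b v q hb hv hv0
        obtain ⟨hbT, hagree⟩ := hWmax b _ _ hv' hv'0
        exact ⟨hbT, fun s hs => hback v s (hagree s hs)⟩

/-! ### rev 2: the Beale–Kato–Majda and gradient-sup doors for data of arbitrary mean -/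

/-- The squared vorticity magnitude of a translate-and-shift is the translate: `|ω[V(·+a) − c]|²(x) =
|ω[V]|²(x + a)` (both are built from `Torus.partialDeriv`). [cite: MajdaBertozzi2002, §1.2 (Galilean invariance)] -/
theorem Torus.torusVorticitySqAt_comp_add_right_sub_const (V : UnitAddTorus d → EuclideanSpace ℝ d)
    (a : UnitAddTorus d) (c : EuclideanSpace ℝ d) (x : UnitAddTorus d) :
    torusVorticitySqAt (fun y => V (y + a) - c) x = torusVorticitySqAt V (x + a) := by
  unfold torusVorticitySqAt
  simp only [Torus.partialDeriv_comp_add_right_sub_const]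

/-- **The Beale–Kato–Majda door, any mean** (Beale–Kato–Majda 1984; Robinson–Rodrigo–Sadowski 2016
Thm 12.3, via the Galilean reduction of the tree's mean-zero `Torus.classicalNS_bkm_continuation`): along a
classical solution of the unforced Navier–Stokes equations with `ν > 0` on `[0,T) × 𝕋^d`, `card d = 3`, a
continuous nonnegative majorant `M` of the vorticity (`|ω(t,x)|² ≤ M(t)²`) with `∫₀ᵗ M ≤ I` on `[0,T)`
yields continuation to a classical solution on some `[0,T']`, `T' > T`, equal to `u` on `[0,T)`.
[cite: RobinsonRodrigoSadowskiCUP2016, Thm 12.3 (with §1.8 on the mean)] -/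
theorem Torus.classicalNS_bkm_continuation_anyMean (hd : Fintype.card d = 3) {ν T : ℝ} (hν : 0 < ν)
    (hT : 0 < T) {u : ℝ → UnitAddTorus d → EuclideanSpace ℝ d} {p : ℝ → UnitAddTorus d → ℝ}
    (h : Torus.IsClassicalNSSolutionOn (Ico 0 T) ν 0 u p)
    {M : ℝ → ℝ} (hMc : ContinuousOn M (Ico 0 T)) (hM0 : ∀ t ∈ Ico 0 T, 0 ≤ M t)
    (hω : ∀ t ∈ Ico 0 T, ∀ x, torusVorticitySqAt (u t) x ≤ M t ^ 2)
    {I : ℝ} (hI : ∀ t ∈ Ico 0 T, ∫ s in (0 : ℝ)..t, M s ≤ I) :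
    ∃ T' : ℝ, T < T' ∧ ∃ (u' : ℝ → UnitAddTorus d → EuclideanSpace ℝ d)
      (p' : ℝ → UnitAddTorus d → ℝ), Torus.IsClassicalNSSolutionOn (Icc 0 T') ν 0 u' p' ∧
        ∀ t ∈ Ico 0 T, u' t = u t := by
  have h0S : (0 : ℝ) ∈ Ico 0 T := ⟨le_rfl, hT⟩
  set m : EuclideanSpace ℝ d := ∫ y, u 0 y with hm
  have hmean : ∀ t ∈ Ico 0 T, ∫ y, u t y = m := fun t ht =>
    h.integral_velocity_eq (convex_Ico 0 T) (fun τ _ => by simp) h0S ht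
  have hv := Torus.isClassicalNSSolutionOn_galileanBoost (uniqueDiffOn_Ico 0 T) h m
  have hvmean : ∀ t ∈ Ico 0 T, Torus.HasZeroMean (fun x => u t (x + Torus.proj (t • m)) - m) := by
    intro t ht
    unfold Torus.HasZeroMean
    rw [Torus.integral_comp_add_right_sub_const (h.smooth_velocity.isSmooth_slice ht).integrable,
      hmean t ht, sub_self]
  have hvω : ∀ t ∈ Ico 0 T, ∀ x,
      torusVorticitySqAt (fun y => u t (y + Torus.proj (t • m)) - m) x ≤ M t ^ 2 := by
    intro t ht x
    rw [Torus.torusVorticitySqAt_comp_add_right_sub_const]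
    exact hω t ht _
  obtain ⟨T', hTT', v', q', hv', -, hagree⟩ :=
    Torus.classicalNS_bkm_continuation hd hν hT hv hvmean hMc hM0 hvω hI
  refine ⟨T', hTT', fun t x => v' t (x + Torus.proj (t • (-m))) - (-m),
    fun t x => q' t (x + Torus.proj (t • (-m))),
    Torus.isClassicalNSSolutionOn_galileanBoost (uniqueDiffOn_Icc (hT.trans hTT')) hv' (-m),
    fun t ht => ?_⟩
  funext x
  show v' t (x + Torus.proj (t • (-m))) - (-m) = u t x
  rw [hagree t ht]
  show u t (x + Torus.proj (t • (-m)) + Torus.proj (t • m)) - m - (-m) = u t x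
  rw [add_assoc, ← Torus.proj_add, ← smul_add, neg_add_cancel, smul_zero, Torus.proj_zero, add_zero,
    sub_neg_eq_add, sub_add_cancel]

/-- **Continuation from `∇u ∈ L¹_t L^∞_x`, any mean** (Robinson–Rodrigo–Sadowski 2016, Notes to Ch. 8 /
Thm 12.3 since `|ω|² ≤ 2|∇u|²_F`; the Galilean reduction of the tree's mean-zero
`Torus.classicalNS_continuation_of_gradientSup_integral_le`): a continuous nonnegative majorant `M` with
`∑ᵢ ‖∂ᵢu(t,x)‖² ≤ M(t)²` and `∫₀ᵗ M ≤ I` on `[0,T)` continues the classical solution past `T`.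
[cite: RobinsonRodrigoSadowskiCUP2016, Thm 12.3 and Notes to Ch. 8 (with §1.8 on the mean)] -/
theorem Torus.classicalNS_continuation_of_gradientSup_integral_le_anyMean (hd : Fintype.card d = 3)
    {ν T : ℝ} (hν : 0 < ν) (hT : 0 < T) {u : ℝ → UnitAddTorus d → EuclideanSpace ℝ d}
    {p : ℝ → UnitAddTorus d → ℝ} (h : Torus.IsClassicalNSSolutionOn (Ico 0 T) ν 0 u p)
    {M : ℝ → ℝ} (hMc : ContinuousOn M (Ico 0 T)) (hM0 : ∀ t ∈ Ico 0 T, 0 ≤ M t)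
    (hM : ∀ t ∈ Ico 0 T, ∀ x, ∑ i, ‖Torus.partialDeriv i (u t) x‖ ^ 2 ≤ M t ^ 2)
    {I : ℝ} (hI : ∀ t ∈ Ico 0 T, ∫ s in (0 : ℝ)..t, M s ≤ I) :
    ∃ T' : ℝ, T < T' ∧ ∃ (u' : ℝ → UnitAddTorus d → EuclideanSpace ℝ d)
      (p' : ℝ → UnitAddTorus d → ℝ), Torus.IsClassicalNSSolutionOn (Icc 0 T') ν 0 u' p' ∧
        ∀ t ∈ Ico 0 T, u' t = u t := by
  refine Torus.classicalNS_bkm_continuation_anyMean hd hν hT h (M := fun t => Real.sqrt 2 * M t)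
    (continuousOn_const.mul hMc) (fun t ht => mul_nonneg (Real.sqrt_nonneg _) (hM0 t ht))
    (fun t ht x => ?_) (I := Real.sqrt 2 * I) (fun t ht => ?_)
  · have h1 := torusVorticitySqAt_le_two_mul_sum_norm_sq (u t) x
    have h2 : (Real.sqrt 2 * M t) ^ 2 = 2 * M t ^ 2 := by
      rw [mul_pow, Real.sq_sqrt (by norm_num : (0 : ℝ) ≤ 2)]
    rw [h2]
    exact h1.trans (by nlinarith [hM t ht x])
  · rw [intervalIntegral.integral_const_mul]
    exact mul_le_mul_of_nonneg_left (hI t ht) (Real.sqrt_nonneg _)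

end Literature.Analysis.FluidPDE

end
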